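import Literature.NumberTheory.EllipticCurves.PAdicLFunctionQuadraticTwistCongruenceAtTwoProofs
import HarnessLib

/-!
# Unit-class Riemann-sum bounds and the scaled depletion lift at `2` (halved tame congruence, generic part)

Cell `bsd-rank2`, seat p2, GEN 64 (helper toward `EisensteinDepletionAtTwo.DepletedLambdaLawAtTwoModNSF`).
Two generic tools, valid for every `E/ℚ` good ordinary at `2`, that the tree's mod-`2` twist congruence
(`exists_iwasawa_twist_congr_two`, normalised so that `μ^{an}(E) = 0` is needed) lacks:

* §1 — Riemann sums of an EVEN character need the measure bound only on the UNIT classes (`a` odd, `b ∈ (ℤ/m)ˣ`):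
  `‖RS(χ)‖ ≤ ‖2‖·C` and `‖RS(χ) − RS(χ')‖ ≤ ‖2‖·ε·C` (the doubling `padicLRiemannSumTame_two_of_even` meets only the
  classes `5ˢ`, and `χ = 0` off the units);
* §2 — the SCALED depletion lift: if `u ∈ Λ` lifts `C(c)·L₂(f,α)` then `(∏ h_ℓ)·u` lifts `C(c)·L₂(f,m,α,𝟙)` and is
  `≡ v·u·∏𝒫_ℓ (mod 2Λ)`, `v ∈ Λˣ` — the case `c = 1` is `exists_iwasawa_padicLFunctionTame_one_congr_two_auto`; a curve
  with `μ^{an} = 1` (e.g. `15A8`, `c = ½`) needs `c ≠ 1`.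

B1 honesty: statements about `2`-adic measures only. [cite: Matsuno2000, Lemmas 3.2–3.3 (p. 87)]
-/

noncomputable section

open scoped Classical MatrixGroups ModularForm

open CongruenceSubgroup NumberField IsDedekindDomain WeierstrassCurve PowerSeries
  Literature.NumberTheory.EllipticCurves Literature.NumberTheory.EllipticCurves.ModularForms
  Literature.NumberTheory.EllipticCurves.GreenbergVatsal2000

namespace Summit.BirchSwinnertonDyer.BirchSwinnertonDyer.Theorems.HalvedTameRiemannSumsAtTwo

/-! ## §0. Helpers -/

section Helpers

/-- A value of a `ℚ_p`-valued Dirichlet character has norm `≤ 1` (it is `0` or a root of unity). [folklore] -/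
private theorem norm_dirichletCharacter_apply_le_one {p m : ℕ} [Fact p.Prime] (χ : DirichletCharacter ℚ_[p] m)
    (b : ZMod m) : ‖χ b‖ ≤ 1 := by
  by_cases hb : IsUnit b
  · obtain ⟨u, rfl⟩ := hb
    have hfin : IsOfFinOrder (χ.toUnitHom u) := MonoidHom.isOfFinOrder _ (isOfFinOrder_of_finite u)
    obtain ⟨k, hk, hpow⟩ := hfin.exists_pow_eq_one
    have hval : (χ (u : ZMod m)) ^ k = 1 := by
      have := congr_arg (fun x : ℚ_[p]ˣ ↦ (x : ℚ_[p])) hpow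
      simpa [MulChar.coe_toUnitHom] using this
    have hn : ‖χ (u : ZMod m)‖ ^ k = 1 := by rw [← norm_pow, hval, norm_one]
    exact (pow_eq_one_iff_of_nonneg (norm_nonneg _) hk.ne').mp hn |>.le
  · rw [χ.map_nonunit hb, norm_zero]
    exact zero_le_one


/-- Distinct finite places of `ℚ` lie over distinct primes. [folklore] -/
private theorem natGenerator_injective_rat :
    Function.Injective (Rat.HeightOneSpectrum.natGenerator (R := 𝓞 ℚ)) := fun _ _ h ↦
  (Rat.HeightOneSpectrum.primesEquiv (R := 𝓞 ℚ)).injective (Subtype.ext h)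

/-- `−(1+T)^{c}` is a unit of `Λ`. [folklore] -/
private theorem isUnit_neg_binomialSeries {p : ℕ} [Fact p.Prime] (c : ℤ_[p]) :
    IsUnit (-PowerSeries.binomialSeries ℤ_[p] c) := by
  refine (isUnit_iff_exists_inv.mpr ⟨PowerSeries.binomialSeries ℤ_[p] (-c), ?_⟩).neg
  rw [← PowerSeries.binomialSeries_add, add_neg_cancel, PowerSeries.binomialSeries_zero]

/-- The residues `5ˢ mod 2ⁿ⁺²` (`γ = 5` topologically generates `1 + 4ℤ₂`) are odd. [folklore] -/
private theorem odd_val_cyclotomicGenerator_pow (n s : ℕ) :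
    Odd ((cyclotomicGenerator 2 : ZMod (2 ^ (n + 2))) ^ s).val := by
  rw [← Nat.cast_pow, ZMod.val_natCast, Nat.odd_iff,
    Nat.mod_mod_of_dvd _ (dvd_pow_self 2 (by omega)), Nat.pow_mod, cyclotomicGenerator_two]
  simp

end Helpers

/-! ## §1. Riemann sums of even characters from a unit-class measure bound -/

section Halved

variable {N : ℕ} [NeZero N] (f : CuspForm (Gamma0 N) 2) {m : ℕ} [NeZero m]

/-- **Riemann sums of an even character from a UNIT-CLASS measure bound**: if `‖μ_{f,α,m}(a,b)‖ ≤ C` for `a` odd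
and `b` a unit, then `‖RS_{k,n}(χ)‖ ≤ ‖2‖·C` for `χ` even (the doubling `padicLRiemannSumTame_two_of_even` only
meets the odd classes `5ˢ`, and `χ(b) = 0` off the units). [cite: MazurTateTeitelbaum1986Invent, §I.13 (pp. 18–19)] -/
theorem norm_padicLRiemannSumTame_two_le_of_units (hm2 : m.Coprime 2) (α : ℚ_[2]) (χ : DirichletCharacter ℚ_[2] m)
    (hχ : χ.Even) {C : ℝ} (hC0 : 0 ≤ C)
    (hC : ∀ (n : ℕ) (a : ZMod (2 ^ (n + 2))) (b : ZMod m), Odd a.val → IsUnit b →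
      ‖msdMeasureTame f m α (n + 2) a b‖ ≤ C) (k n : ℕ) :
    ‖padicLRiemannSumTame f m α χ k n‖ ≤ ‖(2 : ℚ_[2])‖ * C := by
  rw [padicLRiemannSumTame_two_of_even f hm2 α χ hχ, norm_mul]
  gcongr
  refine IsUltrametricDist.norm_sum_le_of_forall_le_of_nonneg hC0 fun s _ ↦ ?_
  refine IsUltrametricDist.norm_sum_le_of_forall_le_of_nonneg hC0 fun b _ ↦ ?_
  by_cases hb : IsUnit b
  · have hc : ‖((s.val.choose k : ℕ) : ℚ_[2])‖ ≤ 1 := by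
      have h := Padic.norm_int_le_one (p := 2) ((s.val.choose k : ℕ) : ℤ)
      rwa [Int.cast_natCast] at h
    rw [norm_mul, norm_mul]
    calc ‖χ b‖ * ‖msdMeasureTame f m α (n + 2) ((cyclotomicGenerator 2 : ZMod (2 ^ (n + 2))) ^ s.val) b‖ *
          ‖((s.val.choose k : ℕ) : ℚ_[2])‖ ≤ 1 * C * 1 :=
          mul_le_mul (mul_le_mul (norm_dirichletCharacter_apply_le_one χ b)
            (hC _ _ _ (odd_val_cyclotomicGenerator_pow n s.val) hb) (norm_nonneg _) zero_le_one) hc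
            (norm_nonneg _) (by positivity)
      _ = C := by ring
  · rw [χ.map_nonunit hb, zero_mul, zero_mul, norm_zero]
    exact hC0

/-- **Termwise difference from a UNIT-CLASS measure bound**: for `χ`, `χ'` even with `‖χ(b) − χ'(b)‖ ≤ ε` and
`‖μ_{f,α,m}‖ ≤ C` on the unit classes, the Riemann sums differ by at most `‖2‖·ε·C`.
[cite: Matsuno2000, Lemma 3.2 (p. 87), proof] -/
theorem norm_padicLRiemannSumTame_sub_two_le_of_units (hm2 : m.Coprime 2) (α : ℚ_[2])
    (χ χ' : DirichletCharacter ℚ_[2] m) (hχ : χ.Even) (hχ' : χ'.Even) {ε : ℝ} (hε : 0 ≤ ε)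
    (hχχ' : ∀ b : ZMod m, ‖χ b - χ' b‖ ≤ ε) {C : ℝ} (hC0 : 0 ≤ C)
    (hC : ∀ (n : ℕ) (a : ZMod (2 ^ (n + 2))) (b : ZMod m), Odd a.val → IsUnit b →
      ‖msdMeasureTame f m α (n + 2) a b‖ ≤ C) (k n : ℕ) :
    ‖padicLRiemannSumTame f m α χ k n - padicLRiemannSumTame f m α χ' k n‖ ≤ ‖(2 : ℚ_[2])‖ * (ε * C) := by
  rw [padicLRiemannSumTame_two_of_even f hm2 α χ hχ, padicLRiemannSumTame_two_of_even f hm2 α χ' hχ', ← mul_sub,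
    norm_mul, ← Finset.sum_sub_distrib]
  gcongr
  refine IsUltrametricDist.norm_sum_le_of_forall_le_of_nonneg (by positivity) fun s _ ↦ ?_
  rw [← Finset.sum_sub_distrib]
  refine IsUltrametricDist.norm_sum_le_of_forall_le_of_nonneg (by positivity) fun b _ ↦ ?_
  by_cases hb : IsUnit b
  · have hc : ‖((s.val.choose k : ℕ) : ℚ_[2])‖ ≤ 1 := by
      have h := Padic.norm_int_le_one (p := 2) ((s.val.choose k : ℕ) : ℤ)
      rwa [Int.cast_natCast] at h
    rw [← sub_mul, ← sub_mul, norm_mul, norm_mul]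
    calc ‖χ b - χ' b‖ * ‖msdMeasureTame f m α (n + 2) ((cyclotomicGenerator 2 : ZMod (2 ^ (n + 2))) ^ s.val) b‖ *
          ‖((s.val.choose k : ℕ) : ℚ_[2])‖ ≤ ε * C * 1 :=
          mul_le_mul (mul_le_mul (hχχ' b) (hC _ _ _ (odd_val_cyclotomicGenerator_pow n s.val) hb) (norm_nonneg _)
            hε) hc (norm_nonneg _) (by positivity)
      _ = ε * C := mul_one _
  · rw [χ.map_nonunit hb, χ'.map_nonunit hb, sub_self, norm_zero]
    positivity

end Halved

/-! ## §2. The scaled depletion lift -/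

section Depletion

variable {N : ℕ} [NeZero N] {f : CuspForm (Gamma0 N) 2}
  {W : WeierstrassCurve ℚ} [W.IsElliptic] [W.IsGloballyMinimal]

/-- **The SCALED depletion lift, for every `E` good ordinary at `2`**: if `u ∈ Λ` lifts `C(c)·L₂(f,α)` then
`G₁ = (∏_{ℓ∈S} h_ℓ)·u` lifts `C(c)·L₂(f,m,α,𝟙_m)` (`h_ℓ = a_ℓ − (1+T)^{−f_ℓ} − (1+T)^{f_ℓ}`, exact identity
`padicLFunctionTame_prod_primes`) and `G₁ ≡ v·u·∏_{ℓ∈S₀}𝒫_ℓ (mod 2Λ)` with `v ∈ Λˣ`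
(`h_ℓ ≡ −(1+T)^{−f_ℓ}·𝒫_ℓ`, `map_toZMod_eulerFactorElement_two_eq`).  The tree's
`exists_iwasawa_padicLFunctionTame_one_congr_two_auto` is the case `c = 1`; the scaling is what lets a curve with
`μ^{an} = 1` (such as `15A8`, `c = ½`) through. [cite: Matsuno2000, Lemma 3.3 and proof of Theorem 3.1 (pp. 87–88)]
[cite: GreenbergVatsal2000, §1 p. 9 (display (8))] -/
theorem exists_scaled_depletion_lift_two (hord : IsOrdinaryAt W 2) (hf : IsNewformOf W f)
    (S₀ : Finset (HeightOneSpectrum (𝓞 ℚ)))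
    (hS2 : ∀ v ∈ S₀, Rat.HeightOneSpectrum.natGenerator v ≠ 2) (hgood : ∀ v ∈ S₀, W.HasGoodReductionAt v)
    {m : ℕ} [NeZero m] (hm : m = ∏ v ∈ S₀, Rat.HeightOneSpectrum.natGenerator v)
    {c : ℚ_[2]} {u : IwasawaAlgebra 2}
    (hu : iwasawaToPowerSeries 2 u = PowerSeries.C c * padicLFunction f (unitRoot W 2 : ℚ_[2])) :
    ∃ (G₁ : IwasawaAlgebra 2) (v : (IwasawaAlgebra 2)ˣ),
      iwasawaToPowerSeries 2 G₁ = PowerSeries.C c * padicLFunctionTame f m (unitRoot W 2 : ℚ_[2]) 1 ∧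
      PowerSeries.map (PadicInt.toZMod (p := 2)) G₁ =
        PowerSeries.map (PadicInt.toZMod (p := 2)) ((v : IwasawaAlgebra 2) * u * eulerFactorProduct W 2 S₀) := by
  obtain ⟨LW, hLW⟩ := exists_iwasawaToPowerSeries_eq_padicLFunction_two_auto hord hf
  obtain ⟨hαeq, hαu, -⟩ := unitRoot_coe_spec (W := W) hord
  have hpN : ¬ 2 ∣ N := not_dvd_level_of_isNewformOf hf hord.1
  have hprime : ∀ v : HeightOneSpectrum (𝓞 ℚ), (Rat.HeightOneSpectrum.natGenerator v).Prime := fun v ↦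
    (Rat.HeightOneSpectrum.primesEquiv v).2
  have hcop : ∀ v ∈ S₀, (Rat.HeightOneSpectrum.natGenerator v).Coprime 2 := fun v hv ↦
    (Nat.coprime_primes (hprime v) Nat.prime_two).mpr (hS2 v hv)
  have hgoodp : ∀ v ∈ S₀, (haveI : Fact (Rat.HeightOneSpectrum.natGenerator v).Prime := ⟨hprime v⟩;
      W.HasGoodReductionAtPrime (Rat.HeightOneSpectrum.natGenerator v)) := fun v hv ↦
    (hasGoodReductionAtPrime_iff_hasGoodReductionAt_ringOfIntegers v W).mpr (hgood v hv)
  -- Teichmüller data `ℓ ≡ ω(ℓ) γ^{f_ℓ}` at every finite level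
  set teich : ℕ → rootsOfUnity (torsionOrder 2) ℤ_[2] := fun ℓ ↦
    if h : ℓ.Coprime 2 then Classical.choose (exists_teichmuller_frobeniusExponent 2 h) else 1 with hteich
  have hc : ∀ ℓ ∈ S₀.image Rat.HeightOneSpectrum.natGenerator, ∀ n : ℕ,
      PadicInt.toZModPow (n + cyclotomicExponent 2) ((teich ℓ : ℤ_[2]ˣ) : ℤ_[2]) *
        (cyclotomicGenerator 2 : ZMod (2 ^ (n + cyclotomicExponent 2))) ^
          (PadicInt.toZModPow n ((fun ℓ : ℕ ↦ frobeniusExponent 2 (ℓ : ℤ_[2])) ℓ)).val =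
          (ℓ : ZMod (2 ^ (n + cyclotomicExponent 2))) := by
    intro ℓ hℓ n
    obtain ⟨v, hv, rfl⟩ := Finset.mem_image.mp hℓ
    have h := hcop v hv
    simp only [hteich, dif_pos h]
    exact Classical.choose_spec (exists_teichmuller_frobeniusExponent 2 h) n
  have hS : ∀ ℓ ∈ S₀.image Rat.HeightOneSpectrum.natGenerator, ℓ.Prime ∧ ¬ ℓ ∣ N ∧ ℓ.Coprime 2 := by
    intro ℓ hℓ
    obtain ⟨v, hv, rfl⟩ := Finset.mem_image.mp hℓ
    haveI : Fact (Rat.HeightOneSpectrum.natGenerator v).Prime := ⟨hprime v⟩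
    exact ⟨hprime v, not_dvd_level_of_isNewformOf hf (hgoodp v hv), hcop v hv⟩
  have ha : ∀ ℓ ∈ S₀.image Rat.HeightOneSpectrum.natGenerator, cuspCoeff f ℓ = ((W.frobeniusTrace ℓ : ℤ) : ℂ) := by
    intro ℓ hℓ
    obtain ⟨v, hv, rfl⟩ := Finset.mem_image.mp hℓ
    haveI : Fact (Rat.HeightOneSpectrum.natGenerator v).Prime := ⟨hprime v⟩
    exact cuspCoeff_eq_frobeniusTrace_of_isNewformOf_holds hf (hgoodp v hv)
  have hinj : ∀ v ∈ S₀, ∀ w ∈ S₀,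
      Rat.HeightOneSpectrum.natGenerator v = Rat.HeightOneSpectrum.natGenerator w → v = w :=
    fun v _ w _ h ↦ natGenerator_injective_rat h
  have hm' : m = ∏ ℓ ∈ S₀.image Rat.HeightOneSpectrum.natGenerator, ℓ := by
    rw [hm, Finset.prod_image hinj]
  -- the exact depletion identity for the canonical lift `LW`
  have hG₁ := iwasawaToPowerSeries_prod_tameEulerFactor_mul hf.1 hf.coeffField_eq_bot hpN
    (cuspCoeff_eq_frobeniusTrace_of_isNewformOf_holds hf hord.1) hαeq hαu (a := W.frobeniusTrace)
    (teich := teich) (c := fun ℓ : ℕ ↦ frobeniusExponent 2 (ℓ : ℤ_[2])) hS ha hc hm' hLW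
  set H : IwasawaAlgebra 2 := ∏ ℓ ∈ S₀.image Rat.HeightOneSpectrum.natGenerator,
    (C ((W.frobeniusTrace ℓ : ℤ) : ℤ_[2]) -
      PowerSeries.binomialSeries ℤ_[2] (-frobeniusExponent 2 (ℓ : ℤ_[2])) -
      PowerSeries.binomialSeries ℤ_[2] (frobeniusExponent 2 (ℓ : ℤ_[2]))) with hH
  -- the unit `v = ∏ (−(1+T)^{−f_ℓ})`
  set uv : HeightOneSpectrum (𝓞 ℚ) → (IwasawaAlgebra 2)ˣ := fun v ↦
    (isUnit_neg_binomialSeries (-frobeniusExponent 2 (Rat.HeightOneSpectrum.natGenerator v : ℤ_[2]))).unit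
    with huv
  have huv_val : ∀ v, ((uv v : (IwasawaAlgebra 2)ˣ) : IwasawaAlgebra 2) =
      -PowerSeries.binomialSeries ℤ_[2] (-frobeniusExponent 2 (Rat.HeightOneSpectrum.natGenerator v : ℤ_[2])) :=
    fun v ↦ IsUnit.unit_spec _
  -- per place: `u_v 𝒫_v ≡ h_ℓ (mod 2)`
  have key : ∀ v ∈ S₀, PowerSeries.map (PadicInt.toZMod (p := 2))
      (C ((W.frobeniusTrace (Rat.HeightOneSpectrum.natGenerator v) : ℤ) : ℤ_[2]) -
        PowerSeries.binomialSeries ℤ_[2] (-frobeniusExponent 2 (Rat.HeightOneSpectrum.natGenerator v : ℤ_[2])) -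
        PowerSeries.binomialSeries ℤ_[2] (frobeniusExponent 2 (Rat.HeightOneSpectrum.natGenerator v : ℤ_[2]))) =
      PowerSeries.map (PadicInt.toZMod (p := 2)) ((uv v : IwasawaAlgebra 2) * eulerFactorElement W 2 v) := by
    intro v hv
    have hE := map_toZMod_eulerFactorElement_two_eq W v (hgood v hv) (hcop v hv)
    rw [frobeniusTraceAt_eq_frobeniusTrace] at hE
    rw [map_mul, hE, ← map_mul, huv_val, frobeniusSeries_eq, ← mul_assoc, neg_mul_neg,
      ← PowerSeries.binomialSeries_add, neg_add_cancel, PowerSeries.binomialSeries_zero, one_mul]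
    rfl
  refine ⟨H * u, ∏ v ∈ S₀, uv v, ?_, ?_⟩
  · -- `ι(H·u) = C(c)·L₂(f,m,α,𝟙)` from `ι(H·LW) = L₂(f,m,α,𝟙)` and `ι u = C(c)·ι LW`
    have h1 : iwasawaToPowerSeries 2 (H * LW) = padicLFunctionTame f m (unitRoot W 2 : ℚ_[2]) 1 := hG₁
    rw [map_mul] at h1 ⊢
    rw [hu, ← hLW, ← h1]
    ring
  · rw [hH, Finset.prod_image hinj, map_mul, map_prod, Finset.prod_congr rfl key, Units.coe_prod,
      eulerFactorProduct_eq, map_mul, map_mul, map_prod, map_prod]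
    simp only [map_mul]
    rw [Finset.prod_mul_distrib]
    ring

end Depletion

end Summit.BirchSwinnertonDyer.BirchSwinnertonDyer.Theorems.HalvedTameRiemannSumsAtTwo

end
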